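import Literature.Probability.LatticeModels.DiscreteFaceBoundary
import Literature.Probability.Percolation.BoxCrossingProofs
import HarnessLib

/-!
# Lattice and metric preliminaries for `DiscretisationFamilyExists` (stmt-CriticalPhenomena-9644)

Elementary facts about the square lattice `δℤ²` and the discrete Dobrushin bookkeeping of
`MedialInterface.lean`, used by the covering lemma
(`CardySusyWardDiscretisationFamilyExistsCover.lean`) which discharges the no-forcing hypotheses of
the marker-free reduction `zdDiscretisationFamily_of_labelling` away from the cut edges:

* mesh-point arithmetic (`meshPoint_add`, `dist_meshPoint_sq`), convexity of the distance along a
  segment (`dist_add_smul_le`, `dist_le_of_mem_segment`), the empty disc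
  `ball z (infDist z ∂Ω) ⊆ Ω` of a point of an open set and its closed version;
* the four diagonal offsets `cornerUnit k + cornerUnit (k + 1)` and the classification of
  lattice points at mesh distance `≤ δ` (neighbours, `adj_of_dist_le`) and `≤ δ√2` (diagonal
  neighbours, `exists_eq_add_diag_of_dist_le`);
* `isInnerFace_of_corner_ball`: a face two of whose opposite corners lie in `Ω_δ`, one of them
  carrying an empty open disc of radius `δ√2`, is an inner face;
* `not_mem_zdBoundary_of_forall_isInnerFace`: a vertex whose four faces are inner is not a site of
  `zdBoundary`.

Everything is proved; nothing is defined.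
-/

noncomputable section

open Set Metric Filter Topology
open Literature.Probability.LatticeModels Literature.Probability.Percolation

namespace Summit.CriticalPhenomena.CardyFormulaZ2.Theorems.DiscretisationFamilyExists

/-! ### Mesh-point arithmetic -/

/-- `meshPoint` is additive. [folklore] -/
theorem meshPoint_add (δ : ℝ) (x y : Site 2) : meshPoint δ (x + y) = meshPoint δ x + meshPoint δ y := by
  have : Site.toComplex (x + y) = Site.toComplex x + Site.toComplex y := by
    apply Complex.ext <;> simp [Site.toComplex]
  rw [meshPoint, meshPoint, meshPoint, this, mul_add]

/-- Squared distance of two mesh points in coordinates. [folklore] -/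
theorem dist_meshPoint_sq (δ : ℝ) (x y : Site 2) :
    dist (meshPoint δ x) (meshPoint δ y) ^ 2 =
      δ ^ 2 * ((((x 0 - y 0 : ℤ)) : ℝ) ^ 2 + (((x 1 - y 1 : ℤ)) : ℝ) ^ 2) := by
  rw [Complex.dist_eq, Complex.sq_norm, Complex.normSq_apply]
  simp only [Complex.sub_re, Complex.sub_im, meshPoint_re, meshPoint_im, Int.cast_sub]
  ring

/-- Norm of a real multiple of a mesh point minus another, in coordinates. [folklore] -/
theorem norm_smul_meshPoint_sub_sq (δ s : ℝ) (x y : Site 2) :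
    ‖s • meshPoint δ x - meshPoint δ y‖ ^ 2 =
      δ ^ 2 * ((s * (x 0 : ℝ) - (y 0 : ℝ)) ^ 2 + (s * (x 1 : ℝ) - (y 1 : ℝ)) ^ 2) := by
  rw [Complex.sq_norm, Complex.normSq_apply]
  simp only [Complex.sub_re, Complex.sub_im, Complex.real_smul, Complex.mul_re, Complex.mul_im,
    Complex.ofReal_re, Complex.ofReal_im, meshPoint_re, meshPoint_im]
  ring

/-- Two corners of one face have mesh points at distance at most `δ√2`. [folklore] -/
theorem dist_corner_corner_le {δ : ℝ} (hδ : 0 ≤ δ) {v w f : Site 2} (hv : IsCorner v f)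
    (hw : IsCorner w f) : dist (meshPoint δ v) (meshPoint δ w) ≤ Real.sqrt 2 * δ := by
  have hc : ∀ i : Fin 2, (((v i - w i : ℤ)) : ℝ) ^ 2 ≤ 1 := by
    intro i
    rcases hv i with h | h <;> rcases hw i with h' | h' <;> rw [h, h'] <;> push_cast <;> ring_nf <;>
      norm_num
  have hsq : dist (meshPoint δ v) (meshPoint δ w) ^ 2 ≤ (Real.sqrt 2 * δ) ^ 2 := by
    rw [dist_meshPoint_sq, mul_pow, Real.sq_sqrt (by norm_num : (0:ℝ) ≤ 2)]
    have h0 := hc 0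
    have h1 := hc 1
    nlinarith [sq_nonneg δ]
  exact (pow_le_pow_iff_left₀ dist_nonneg (by positivity) two_ne_zero).1 hsq

/-- A convex combination is no farther from a point than the corresponding combination of the
distances of its ends. [folklore] -/
theorem dist_add_smul_le {a b c : ℂ} {t : ℝ} (ht0 : 0 ≤ t) (ht1 : t ≤ 1) :
    dist (a + t • (b - a)) c ≤ (1 - t) * dist a c + t * dist b c := by
  have key : a + t • (b - a) - c = (1 - t) • (a - c) + t • (b - c) := by
    simp only [Complex.real_smul]; push_cast; ring
  rw [dist_eq_norm, key, dist_eq_norm, dist_eq_norm]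
  calc ‖(1 - t) • (a - c) + t • (b - c)‖ ≤ ‖(1 - t) • (a - c)‖ + ‖t • (b - c)‖ := norm_add_le _ _
    _ = (1 - t) * ‖a - c‖ + t * ‖b - c‖ := by
      rw [norm_smul, norm_smul, Real.norm_of_nonneg (by linarith), Real.norm_of_nonneg ht0]

/-- A point of the segment `[a, b]` is within `max (dist a c) (dist b c)`-type bounds of `c`:
if both ends are within `r` of `c`, so is the whole segment. [folklore] -/
theorem dist_le_of_mem_segment {a b c z : ℂ} (hz : z ∈ segment ℝ a b) {r : ℝ}
    (ha : dist a c ≤ r) (hb : dist b c ≤ r) : dist z c ≤ r := by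
  rw [segment_eq_image'] at hz
  obtain ⟨t, ⟨ht0, ht1⟩, rfl⟩ := hz
  calc dist (a + t • (b - a)) c ≤ (1 - t) * dist a c + t * dist b c := dist_add_smul_le ht0 ht1
    _ ≤ (1 - t) * r + t * r := by gcongr
    _ = r := by ring

/-- The open disc about a point of an open set with radius its distance to the frontier lies in
the set. [folklore] -/
theorem ball_infDist_frontier_subset' {Ω : Set ℂ} (hΩ : IsOpen Ω) {z : ℂ} (hz : z ∈ Ω) :
    ball z (infDist z (frontier Ω)) ⊆ Ω := by
  intro w hw
  by_contra hwΩ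
  obtain ⟨q, hq, hqf⟩ := exists_mem_segment_frontier hΩ hz
    (fun h => hwΩ (h (right_mem_segment ℝ z w)))
  have h1 : infDist z (frontier Ω) ≤ dist z q := infDist_le_dist_of_mem hqf
  have h2 : dist q z ≤ dist w z :=
    dist_le_of_mem_segment hq (by rw [dist_self]; exact dist_nonneg) le_rfl
  rw [mem_ball] at hw
  rw [dist_comm] at h1
  linarith

/-- The closed disc about a point of an open set with radius its (positive) distance to the
frontier lies in the closure of the set. [folklore] -/
theorem closedBall_infDist_frontier_subset {Ω : Set ℂ} (hΩ : IsOpen Ω) {z : ℂ} (hz : z ∈ Ω)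
    (hpos : 0 < infDist z (frontier Ω)) :
    closedBall z (infDist z (frontier Ω)) ⊆ closure Ω := by
  rw [← closure_ball z hpos.ne']
  exact closure_mono (ball_infDist_frontier_subset' hΩ hz)

/-! ### Diagonal neighbours -/

/-! The diagonal offset of the face `k` at a vertex is `cornerUnit k + cornerUnit (k + 1)`, i.e.
`(1,1), (-1,1), (-1,-1), (1,-1)` for `k = 0, 1, 2, 3`; we keep it inlined (no definition). -/

/-- The coordinates of a diagonal offset are `±1`. [folklore] -/
theorem diag_apply (k : Fin 4) (i : Fin 2) : (cornerUnit k + cornerUnit (k + 1)) i = 1 ∨ (cornerUnit k + cornerUnit (k + 1)) i = -1 := by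
  fin_cases k <;> fin_cases i <;> decide

/-- The coordinates of a diagonal offset square to one. [folklore] -/
theorem diag_apply_sq (k : Fin 4) (i : Fin 2) : (((cornerUnit k + cornerUnit (k + 1)) i : ℤ) : ℝ) ^ 2 = 1 := by
  rcases diag_apply k i with h | h <;> rw [h] <;> norm_num

/-- The coordinates of a diagonal offset are non-zero. [folklore] -/
theorem diag_apply_ne_zero (k : Fin 4) (i : Fin 2) : (cornerUnit k + cornerUnit (k + 1)) i ≠ 0 := by
  rcases diag_apply k i with h | h <;> rw [h] <;> decide

/-- Two diagonal offsets with both coordinate products positive coincide. [folklore] -/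
theorem diag_eq_of_mul_pos {j k : Fin 4} (h0 : 0 < (cornerUnit j + cornerUnit (j + 1)) 0 * (cornerUnit k + cornerUnit (k + 1)) 0) (h1 : 0 < (cornerUnit j + cornerUnit (j + 1)) 1 * (cornerUnit k + cornerUnit (k + 1)) 1) :
    (cornerUnit j + cornerUnit (j + 1)) = (cornerUnit k + cornerUnit (k + 1)) := by
  funext i
  fin_cases i
  · show (cornerUnit j + cornerUnit (j + 1)) 0 = (cornerUnit k + cornerUnit (k + 1)) 0
    rcases diag_apply j 0 with h | h <;> rcases diag_apply k 0 with h' | h' <;>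
      rw [h, h'] at h0 ⊢ <;> omega
  · show (cornerUnit j + cornerUnit (j + 1)) 1 = (cornerUnit k + cornerUnit (k + 1)) 1
    rcases diag_apply j 1 with h | h <;> rcases diag_apply k 1 with h' | h' <;>
      rw [h, h'] at h1 ⊢ <;> omega

/-- The mesh point of the diagonal neighbour. [folklore] -/
theorem meshPoint_add_diag (δ : ℝ) (y : Site 2) (k : Fin 4) :
    meshPoint δ (y + (cornerUnit k + cornerUnit (k + 1))) = meshPoint δ y + meshPoint δ ((cornerUnit k + cornerUnit (k + 1))) := meshPoint_add δ y ((cornerUnit k + cornerUnit (k + 1)))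

/-- A diagonal neighbour is at distance `δ√2`. [folklore] -/
theorem dist_meshPoint_add_diag {δ : ℝ} (hδ : 0 ≤ δ) (y : Site 2) (k : Fin 4) :
    dist (meshPoint δ (y + (cornerUnit k + cornerUnit (k + 1)))) (meshPoint δ y) = Real.sqrt 2 * δ := by
  have hsq : dist (meshPoint δ (y + (cornerUnit k + cornerUnit (k + 1)))) (meshPoint δ y) ^ 2 = (Real.sqrt 2 * δ) ^ 2 := by
    rw [dist_meshPoint_sq, mul_pow, Real.sq_sqrt (by norm_num : (0:ℝ) ≤ 2)]
    have hsub : ∀ i, (y + (cornerUnit k + cornerUnit (k + 1))) i - y i =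
        (cornerUnit k + cornerUnit (k + 1)) i := fun i => by rw [Pi.add_apply]; ring
    rw [hsub, hsub, diag_apply_sq, diag_apply_sq]; ring
  exact (pow_left_inj₀ dist_nonneg (by positivity) two_ne_zero).1 hsq

/-- The norm of a diagonal offset mesh vector is `δ√2`. [folklore] -/
theorem norm_meshPoint_diag {δ : ℝ} (hδ : 0 ≤ δ) (k : Fin 4) :
    ‖meshPoint δ ((cornerUnit k + cornerUnit (k + 1)))‖ = Real.sqrt 2 * δ := by
  have := dist_meshPoint_add_diag hδ 0 k
  rwa [zero_add, dist_eq_norm, show meshPoint δ (0 : Site 2) = 0 by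
    simp [meshPoint, Site.toComplex, Complex.ext_iff], sub_zero] at this

/-- **Lattice points within `δ√2`.** A lattice point other than `y` and its four neighbours whose
mesh point is within `δ√2` of that of `y` is one of the four diagonal neighbours `y + (cornerUnit k + cornerUnit (k + 1))`.
[folklore] -/
theorem exists_eq_add_diag_of_dist_le {δ : ℝ} (hδ : 0 < δ) {x y : Site 2} (hne : x ≠ y)
    (hadj : ¬ (zdGraph 2).Adj y x) (hd : dist (meshPoint δ x) (meshPoint δ y) ≤ Real.sqrt 2 * δ) :
    ∃ k : Fin 4, x = y + (cornerUnit k + cornerUnit (k + 1)) := by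
  obtain ⟨a, ha⟩ : ∃ a : ℤ, x 0 = y 0 + a := ⟨x 0 - y 0, by ring⟩
  obtain ⟨b, hb⟩ : ∃ b : ℤ, x 1 = y 1 + b := ⟨x 1 - y 1, by ring⟩
  have hsq : ((a : ℝ)) ^ 2 + ((b : ℝ)) ^ 2 ≤ 2 := by
    have h2 : dist (meshPoint δ x) (meshPoint δ y) ^ 2 ≤ (Real.sqrt 2 * δ) ^ 2 :=
      pow_le_pow_left₀ dist_nonneg hd 2
    rw [dist_meshPoint_sq, mul_pow, Real.sq_sqrt (by norm_num : (0:ℝ) ≤ 2), ha, hb] at h2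
    simp only [add_sub_cancel_left] at h2
    have hδ2 : 0 < δ ^ 2 := by positivity
    nlinarith
  have hab : a ^ 2 + b ^ 2 ≤ 2 := by exact_mod_cast hsq
  have ha1 : a ≤ 1 := by nlinarith [sq_nonneg b]
  have ha2 : -1 ≤ a := by nlinarith [sq_nonneg b]
  have hb1 : b ≤ 1 := by nlinarith [sq_nonneg a]
  have hb2 : -1 ≤ b := by nlinarith [sq_nonneg a]
  have hx : x = y + (fun i : Fin 2 => if i = 0 then a else b) := by
    funext i; fin_cases i <;> simp [ha, hb]
  -- the nine cases
  have key : ∀ (a b : ℤ), -1 ≤ a → a ≤ 1 → -1 ≤ b → b ≤ 1 →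
      x = y + (fun i : Fin 2 => if i = 0 then a else b) → ∃ k : Fin 4, x = y + (cornerUnit k + cornerUnit (k + 1)) := by
    intro a b ha2 ha1 hb2 hb1 hx
    interval_cases a <;> interval_cases b
    · exact ⟨2, by rw [hx]; congr 1; funext i; fin_cases i <;> decide⟩
    · exact absurd ((zdGraph_adj_iff y x).2 ⟨0, Or.inr (by rw [hx]; funext i; fin_cases i <;> simp)⟩) hadj
    · exact ⟨1, by rw [hx]; congr 1; funext i; fin_cases i <;> decide⟩
    · exact absurd ((zdGraph_adj_iff y x).2 ⟨1, Or.inr (by rw [hx]; funext i; fin_cases i <;> simp)⟩) hadj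
    · exact absurd (by rw [hx]; funext i; fin_cases i <;> simp) hne
    · exact absurd ((zdGraph_adj_iff y x).2 ⟨1, Or.inl (by rw [hx]; funext i; fin_cases i <;> simp)⟩) hadj
    · exact ⟨3, by rw [hx]; congr 1; funext i; fin_cases i <;> decide⟩
    · exact absurd ((zdGraph_adj_iff y x).2 ⟨0, Or.inl (by rw [hx]; funext i; fin_cases i <;> simp)⟩) hadj
    · exact ⟨0, by rw [hx]; congr 1; funext i; fin_cases i <;> decide⟩
  exact key a b ha2 ha1 hb2 hb1 hx

/-- **Lattice points within `δ`.** A lattice point other than `y` whose mesh point is within `δ`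
of that of `y` is a lattice neighbour of `y`. [folklore] -/
theorem adj_of_dist_le {δ : ℝ} (hδ : 0 < δ) {x y : Site 2} (hne : x ≠ y)
    (hd : dist (meshPoint δ x) (meshPoint δ y) ≤ δ) : (zdGraph 2).Adj y x := by
  obtain ⟨a, ha⟩ : ∃ a : ℤ, x 0 = y 0 + a := ⟨x 0 - y 0, by ring⟩
  obtain ⟨b, hb⟩ : ∃ b : ℤ, x 1 = y 1 + b := ⟨x 1 - y 1, by ring⟩
  have hsq : ((a : ℝ)) ^ 2 + ((b : ℝ)) ^ 2 ≤ 1 := by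
    have h2 : dist (meshPoint δ x) (meshPoint δ y) ^ 2 ≤ δ ^ 2 := pow_le_pow_left₀ dist_nonneg hd 2
    rw [dist_meshPoint_sq, ha, hb] at h2
    simp only [add_sub_cancel_left] at h2
    have hδ2 : 0 < δ ^ 2 := by positivity
    nlinarith
  have hab : a ^ 2 + b ^ 2 ≤ 1 := by exact_mod_cast hsq
  have ha1 : a ≤ 1 := by nlinarith [sq_nonneg b]
  have ha2 : -1 ≤ a := by nlinarith [sq_nonneg b]
  have hb1 : b ≤ 1 := by nlinarith [sq_nonneg a]
  have hb2 : -1 ≤ b := by nlinarith [sq_nonneg a]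
  have hx : x = y + (fun i : Fin 2 => if i = 0 then a else b) := by
    funext i; fin_cases i <;> simp [ha, hb]
  have key : ∀ (a b : ℤ), -1 ≤ a → a ≤ 1 → -1 ≤ b → b ≤ 1 → a ^ 2 + b ^ 2 ≤ 1 →
      x = y + (fun i : Fin 2 => if i = 0 then a else b) → (zdGraph 2).Adj y x := by
    intro a b ha2 ha1 hb2 hb1 hab hx
    interval_cases a <;> interval_cases b
    · norm_num at hab
    · exact (zdGraph_adj_iff y x).2 ⟨0, Or.inr (by rw [hx]; funext i; fin_cases i <;> simp)⟩
    · norm_num at hab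
    · exact (zdGraph_adj_iff y x).2 ⟨1, Or.inr (by rw [hx]; funext i; fin_cases i <;> simp)⟩
    · exact absurd (by rw [hx]; funext i; fin_cases i <;> simp) hne
    · exact (zdGraph_adj_iff y x).2 ⟨1, Or.inl (by rw [hx]; funext i; fin_cases i <;> simp)⟩
    · norm_num at hab
    · exact (zdGraph_adj_iff y x).2 ⟨0, Or.inl (by rw [hx]; funext i; fin_cases i <;> simp)⟩
    · norm_num at hab
  exact key a b ha2 ha1 hb2 hb1 hab hx

/-- `y + (cornerUnit k + cornerUnit (k + 1))` is the corner of the face `k` at `y` opposite to `y`. [folklore] -/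
theorem isCorner_add_diag_faceAt (y : Site 2) (k : Fin 4) : IsCorner (y + (cornerUnit k + cornerUnit (k + 1))) (faceAt y k) := by
  rw [← faceAt_add_unit_succ y k, ← add_assoc]
  exact (isCorner_add_faceAt_iff (y + cornerUnit k) (k + 1) (k + 1)).2 (Or.inl rfl)

/-! ### Faces with an empty diagonal disc are inner -/

/-- **A face with two opposite corners `p, q` in `Ω_δ`, the open disc of radius `δ√2` about `δq`
lying in `Ω`, is an inner face**: the two remaining corners are within `δ` of `δq`, the sides at
`q` lie in the disc, and the sides at `p` lie in the disc except for their end `δp ∈ Ω`; so all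
four sides are mesh edges and all corners are joined to `q` in the mesh graph. [folklore] -/
theorem isInnerFace_of_corner_ball {E : DiscreteDobrushin} (hδ : 0 < E.δ) {f p q : Site 2}
    (hp : IsCorner p f) (hq : IsCorner q f) (hpq : ∀ i, p i ≠ q i)
    (hpD : p ∈ meshDomain E.Ω E.δ) (hqD : q ∈ meshDomain E.Ω E.δ)
    (hball : ball (meshPoint E.δ q) (Real.sqrt 2 * E.δ) ⊆ E.Ω) : E.IsInnerFace f := by
  set δ := E.δ with hδdef
  have hpΩ : meshPoint δ p ∈ E.Ω := meshDomain_subset_meshVertices _ _ hpD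
  -- coordinates of corners relative to `p`, `q`
  have hcoord : ∀ v, IsCorner v f → ∀ i, v i = p i ∨ v i = q i := by
    intro v hv i
    rcases hv i with h | h <;> rcases hp i with h1 | h1 <;> rcases hq i with h2 | h2
    all_goals first | exact Or.inl (h.trans h1.symm) | exact Or.inr (h.trans h2.symm) |
      exact absurd (h1.trans h2.symm) (hpq i)
  -- a corner other than `p` is within `δ` of `δq`
  have hnear : ∀ v, IsCorner v f → v ≠ p → dist (meshPoint δ v) (meshPoint δ q) ≤ δ := by
    intro v hv hvp
    have hex : ∃ i, v i = q i := by
      by_contra h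
      push Not at h
      exact hvp (funext fun i => (hcoord v hv i).resolve_right (h i))
    have hc : ∀ i : Fin 2, (((v i - q i : ℤ)) : ℝ) ^ 2 ≤ 1 := fun i => by
      rcases hv i with h | h <;> rcases hq i with h' | h' <;> rw [h, h'] <;> push_cast <;> ring_nf <;>
        norm_num
    have hsq : dist (meshPoint δ v) (meshPoint δ q) ^ 2 ≤ δ ^ 2 := by
      rw [dist_meshPoint_sq]
      obtain ⟨i, hi⟩ := hex
      fin_cases i
      · have h1 := hc 1
        have hi' : v 0 = q 0 := hi
        rw [hi', sub_self]; push_cast at h1 ⊢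
        nlinarith [sq_nonneg δ]
      · have h0 := hc 0
        have hi' : v 1 = q 1 := hi
        rw [hi', sub_self]; push_cast at h0 ⊢
        nlinarith [sq_nonneg δ]
    exact (pow_le_pow_iff_left₀ dist_nonneg hδ.le two_ne_zero).1 hsq
  have hlt : δ < Real.sqrt 2 * δ := by
    have : (1 : ℝ) < Real.sqrt 2 := Real.lt_sqrt zero_le_one |>.2 (by norm_num)
    nlinarith
  -- mesh points of all corners are in `Ω`
  have hΩv : ∀ v, IsCorner v f → meshPoint δ v ∈ E.Ω := by
    intro v hv
    by_cases hvp : v = p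
    · rw [hvp]; exact hpΩ
    · exact hball (mem_ball.2 ((hnear v hv hvp).trans_lt hlt))
  -- all sides lie in `Ω`
  have hside : ∀ v w, IsCorner v f → IsCorner w f → (zdGraph 2).Adj v w →
      segment ℝ (meshPoint δ v) (meshPoint δ w) ⊆ E.Ω := by
    intro v w hv hw hvw z hz
    rw [segment_eq_image'] at hz
    obtain ⟨t, ⟨ht0, ht1⟩, rfl⟩ := hz
    have hle := dist_add_smul_le (a := meshPoint δ v) (b := meshPoint δ w) (c := meshPoint δ q) ht0 ht1
    by_cases hvp : v = p
    · -- `w ≠ p`, so `w` is near `q`; the point is in the disc unless `t = 0`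
      have hwp : w ≠ p := fun h => hvw.ne (hvp.trans h.symm)
      rcases ht0.eq_or_lt with rfl | ht0'
      · simpa using hΩv v hv
      · refine hball (mem_ball.2 (hle.trans_lt ?_))
        have h1 : dist (meshPoint δ v) (meshPoint δ q) ≤ Real.sqrt 2 * δ := by
          rw [hvp]; exact dist_corner_corner_le hδ.le hp hq
        have h2 := hnear w hw hwp
        calc (1 - t) * dist (meshPoint δ v) (meshPoint δ q) + t * dist (meshPoint δ w) (meshPoint δ q)
            ≤ (1 - t) * (Real.sqrt 2 * δ) + t * δ := by gcongr
          _ < (1 - t) * (Real.sqrt 2 * δ) + t * (Real.sqrt 2 * δ) := by gcongr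
          _ = Real.sqrt 2 * δ := by ring
    · by_cases hwp : w = p
      · rcases ht1.eq_or_lt with rfl | ht1'
        · simpa using hΩv w hw
        · refine hball (mem_ball.2 (hle.trans_lt ?_))
          have h1 : dist (meshPoint δ w) (meshPoint δ q) ≤ Real.sqrt 2 * δ := by
            rw [hwp]; exact dist_corner_corner_le hδ.le hp hq
          have h2 := hnear v hv hvp
          calc (1 - t) * dist (meshPoint δ v) (meshPoint δ q) + t * dist (meshPoint δ w) (meshPoint δ q)
              ≤ (1 - t) * δ + t * (Real.sqrt 2 * δ) := by gcongr
            _ < (1 - t) * (Real.sqrt 2 * δ) + t * (Real.sqrt 2 * δ) := by gcongr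
            _ = Real.sqrt 2 * δ := by ring
      · refine hball (mem_ball.2 (hle.trans_lt ?_))
        have h1 := hnear v hv hvp
        have h2 := hnear w hw hwp
        calc (1 - t) * dist (meshPoint δ v) (meshPoint δ q) + t * dist (meshPoint δ w) (meshPoint δ q)
            ≤ (1 - t) * δ + t * δ := by gcongr
          _ = δ := by ring
          _ < Real.sqrt 2 * δ := hlt
  -- all corners are in `Ω_δ`
  have hmeshAdj : ∀ v w, IsCorner v f → IsCorner w f → (zdGraph 2).Adj v w →
      (meshGraph E.Ω δ).Adj v w := fun v w hv hw hvw =>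
    meshGraph_adj_iff.2 ⟨hvw, (hside v w hv hw hvw).trans subset_closure⟩
  have hD : ∀ v, IsCorner v f → v ∈ meshDomain E.Ω δ := by
    intro v hv
    by_cases hvp : v = p
    · rw [hvp]; exact hpD
    by_cases hvq : v = q
    · rw [hvq]; exact hqD
    -- `v` is within `δ` of `q`, hence a lattice neighbour of `q`
    have hvq' : (zdGraph 2).Adj q v := adj_of_dist_le hδ hvq (hnear v hv hvp)
    exact mem_meshDomain_of_meshGraph_adj hqD (hΩv v hv) (hmeshAdj q v hq hv hvq')
  intro v w hv hw hvw
  exact discreteDomainGraph_adj_iff.2 ⟨hmeshAdj v w hv hw hvw, hD v hv, hD w hw⟩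

/-- **A vertex all four of whose faces are inner is not a boundary site**: its four lattice
neighbours are joined to it by sides of inner faces, and no face cornered at it is non-inner.
[folklore] -/
theorem not_mem_zdBoundary_of_forall_isInnerFace {E : DiscreteDobrushin} {y : Site 2}
    (h : ∀ k : Fin 4, E.IsInnerFace (faceAt y k)) : y ∉ E.zdBoundary := by
  rintro (hy | ⟨w, -, -, g, hg, hyg, -⟩)
  · obtain ⟨-, w, hyw, hnadj⟩ := mem_meshBoundary_iff.1 hy
    obtain ⟨k, rfl⟩ := exists_eq_add_cornerUnit hyw
    exact hnadj (h k y _ (isCorner_faceAt y k) ((isCorner_add_faceAt_iff y k k).2 (Or.inl rfl)) hyw)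
  · obtain ⟨k, rfl⟩ := exists_faceAt_of_isCorner hyg
    exact hg (h k)

end Summit.CriticalPhenomena.CardyFormulaZ2.Theorems.DiscretisationFamilyExists

end
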